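import Literature.MathematicalPhysics.QuantumFieldTheory.TwistedPartitionFunctionMonotoneStrict
import Literature.MathematicalPhysics.QuantumFieldTheory.StrongCouplingStringTension
import Literature.MathematicalPhysics.QuantumLattice.TwistEaterIrreducibility
import HarnessLib

/-!
# The strong-coupling vortex FLOOR, uniform in the volume (registered stub `stub_strongCouplingFloor` of the crux
# `FluxSectorAlternative.NoHiggsMode`, ⟨stmt-QuantumFields-23870⟩, LINE g20-A of planner ym-idea-4; prover ym-dw-p1 g20)

The BC3 birth skeleton of `NoHiggsMode` (HOME `pub/ideators/ym-idea-4/bc/g20-A/bc/NoHiggsMode_birth.lean`, namespace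
`Summit.QuantumFields.YangMills.Theses.FluxSectorAlternativeBirthK2`) registers two stubs: `stub_strongCouplingFloor :
StrongCouplingFloorP` (this file) and the XL `stub_vortexFreeEnergyLipschitz`.  `StrongCouplingFloorP` — copied below letter for
letter — asks, for `SU(N)`, `N ≥ 2`, every lattice representation `r`, every central `z` and every plane `q`, for a threshold
`β₀ > 0` and a constant `c > 0` with `c ≤ Z_z(L)/Z_1(L)` for ALL `0 < β ≤ β₀` and ALL tori `L ≥ 2`.

Proof: the tree's strong-coupling cluster expansion (`CentralTwist.one_sub_twistZ_div_twistZ_le_pow`,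
StrongCouplingStringTension.lean; Münster 1981 §3.1, Ito–Seiler 2008 Thm 2.2 (1)) in the stack dictionary
`MultiTwist.twistZ_mulSingle` (the same bridging as the g20-B rung file's `VortexVolumeRatchet.deficit_ceiling`, inlined) gives `1 − Z_z(L)/Z_1(L) ≤ 2·4²·L⁴·(X|β|)^{L²}`, `X = 4e N_r (8·3+1)²`, for `|β| ≤ β_KP(N_r)`;
with `β₀ = min β_KP (1/(8X))` the right side is `≤ 32 L⁴ 8^{−L²} ≤ 1/2` for every `L ≥ 2`, so `c = 1/2` works (no parity, no
dyadic restriction).  HONEST FRAMING: this is the EASY stub (the cluster expansion was in the tree); `NoHiggsMode` itself needs the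
XL stub (volume-uniform Lipschitz control of the vortex free energy in `β` beyond strong coupling) and is NOT proved here; nothing
here bears on any summit statement or the Yang–Mills mass gap.  Standard axioms, no `sorry`.
-/

set_option autoImplicit false

noncomputable section

open MeasureTheory
open Literature.MathematicalPhysics.QuantumFieldTheory Literature.MathematicalPhysics.QuantumLattice

namespace Summit.QuantumFields.YangMills.Theorems.FluxSectorAlternative

/-- The registered stub's statement, letter for letter (birth skeleton of stmt-QuantumFields-23870, namespace
`Summit.QuantumFields.YangMills.Theses.FluxSectorAlternativeBirthK2`, stub `stub_strongCouplingFloor : StrongCouplingFloorP`):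
a volume-uniform floor `c ≤ Z_z(L)/Z_1(L)` of every single-plane vortex ratio of `SU(N)` (action `r`) throughout a
strong-coupling window `0 < β ≤ β₀(N, r, z, q)`, all tori `L ≥ 2`. [problem-side] -/
def StrongCouplingFloorP : Prop :=
  ∀ N : ℕ, 2 ≤ N → ∀ r : LatticeRep (Matrix.specialUnitaryGroup (Fin N) ℂ),
    ∀ z : Matrix.specialUnitaryGroup (Fin N) ℂ, z ∈ Subgroup.center (Matrix.specialUnitaryGroup (Fin N) ℂ) →
      ∀ q : {p : Fin 4 × Fin 4 // p.1 < p.2}, ∃ β₀ c : ℝ, 0 < β₀ ∧ 0 < c ∧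
        ∀ β : ℝ, 0 < β → β ≤ β₀ → ∀ (L : ℕ) [NeZero L], 2 ≤ L →
          c ≤ twistedPartitionFunction r.ρ β L z q / twistedPartitionFunction r.ρ β L 1 q


/-- `64 L⁴ ≤ 8^{L²}` for `L ≥ 2` (`L ≤ 2^{L−1}`, `4L + 2 ≤ 3L²`). -/
theorem sixtyfour_mul_pow_four_le (L : ℕ) (hL : 2 ≤ L) : 64 * L ^ 4 ≤ 8 ^ (L ^ 2) := by
  have h1 : L ≤ 2 ^ (L - 1) := by
    have := @Nat.lt_two_pow_self (L - 1)
    omega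
  have h2 : 4 * (L - 1) + 6 ≤ 3 * L ^ 2 := by
    have e : 4 * (L - 1) + 6 = 4 * L + 2 := by omega
    rw [e]
    nlinarith [Nat.mul_le_mul hL hL]
  calc 64 * L ^ 4 ≤ 64 * (2 ^ (L - 1)) ^ 4 := by gcongr
    _ = 2 ^ (4 * (L - 1) + 6) := by rw [← pow_mul, pow_add]; norm_num; ring
    _ ≤ 2 ^ (3 * L ^ 2) := Nat.pow_le_pow_right (by norm_num) h2
    _ = 8 ^ (L ^ 2) := by rw [pow_mul]; norm_num

/-- A faithful representation of `SU(N)`, `N ≥ 2`, has positive dimension. -/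
theorem latticeRep_dim_pos_of_two_le {N : ℕ} (hN : 2 ≤ N) (r : LatticeRep (Matrix.specialUnitaryGroup (Fin N) ℂ)) : 1 ≤ r.N := by
  by_contra h
  have h0 : r.N = 0 := by omega
  apply suCenter_ne_one_of_isUnit N hN isUnit_one
  apply r.injective
  ext i k
  exact absurd i.2 (by omega)

/-- **The registered stub `stub_strongCouplingFloor` of the `NoHiggsMode` birth skeleton, PROVED** (letter for letter
`StrongCouplingFloorP`): with `X = 4eN_r(8·3+1)²`, `β_KP = 1/(4N_r(8·3+1)²e²)` and `β₀ = min β_KP (1/(8X))`, for `0 < β ≤ β₀`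
and every torus `L ≥ 2` the vortex deficit is `≤ 32 L⁴ 8^{−L²} ≤ 1/2`, hence `Z_z(L)/Z_1(L) ≥ 1/2`. -/
theorem stub_strongCouplingFloor : StrongCouplingFloorP := by
  intro N hN r z hz q
  haveI : SecondCountableTopology (Matrix.specialUnitaryGroup (Fin N) ℂ) := by
    haveI : SecondCountableTopology (Matrix (Fin N) (Fin N) ℂ) :=
      inferInstanceAs (SecondCountableTopology (Fin N → Fin N → ℂ))
    exact TopologicalSpace.Subtype.secondCountableTopology (α := Matrix (Fin N) (Fin N) ℂ) _
  have hNr : 1 ≤ r.N := latticeRep_dim_pos_of_two_le hN r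
  have hNr0 : (0 : ℝ) < r.N := by exact_mod_cast hNr
  set X : ℝ := 4 * Real.exp 1 * r.N * ((((8 * (4 - 1) : ℕ) : ℝ) + 1) ^ 2) with hX_def
  set βKP : ℝ := 1 / (4 * r.N * ((((8 * (4 - 1) : ℕ) : ℝ) + 1) ^ 2 * Real.exp 2)) with hβKP_def
  have hX0 : 0 < X := by positivity
  have hβKP0 : 0 < βKP := by positivity
  refine ⟨min βKP (1 / (8 * X)), 1 / 2, lt_min hβKP0 (by positivity), by norm_num, fun β hβ hb L _ hL => ?_⟩
  have hbKP : β ≤ βKP := hb.trans (min_le_left _ _)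
  have hbX : β ≤ 1 / (8 * X) := hb.trans (min_le_right _ _)
  have hβabs : |β| = β := abs_of_pos hβ
  have hβKP' : |β| ≤ 1 / (4 * r.N * ((((8 * (4 - 1) : ℕ) : ℝ) + 1) ^ 2 * Real.exp 2)) := by rw [hβabs]; exact hbKP
  -- deficit ceiling (cluster expansion through the stack dictionary; the same bridging as the tree's
  -- `VortexVolumeRatchet.deficit_ceiling`, inlined to keep this module route-independent)
  have hce : 1 - twistedPartitionFunction r.ρ β L z q / twistedPartitionFunction r.ρ β L 1 q ≤
      2 * ((4 : ℕ) : ℝ) ^ 2 * (L : ℝ) ^ (4 : ℕ) *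
        (4 * Real.exp 1 * r.N * ((((8 * (4 - 1) : ℕ) : ℝ) + 1) ^ 2) * |β|) ^ (L ^ 2) := by
    have h := CentralTwist.one_sub_twistZ_div_twistZ_le_pow (d := 4) (L := L) r.ρ r.continuous hβKP'
      (1 : Twist 4 (Matrix.specialUnitaryGroup (Fin N) ℂ))
      (Pi.mulSingle q (⟨z, hz⟩ : Subgroup.center (Matrix.specialUnitaryGroup (Fin N) ℂ)))
    have e1 : TwistedSector.twistZ r.ρ (Pi.mulSingle q (⟨z, hz⟩ : Subgroup.center (Matrix.specialUnitaryGroup (Fin N) ℂ)))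
        β L = twistedPartitionFunction (d := 4) r.ρ β L z q :=
      MultiTwist.twistZ_mulSingle r.ρ β r.continuous q ⟨z, hz⟩
    have e2 : TwistedSector.twistZ r.ρ (1 : Twist 4 (Matrix.specialUnitaryGroup (Fin N) ℂ)) β L =
        twistedPartitionFunction (d := 4) r.ρ β L 1 q := by
      have h1 := MultiTwist.twistZ_mulSingle (d := 4) (L := L) r.ρ β r.continuous q
        (1 : Subgroup.center (Matrix.specialUnitaryGroup (Fin N) ℂ))
      rw [Pi.mulSingle_one] at h1
      simpa using h1
    rw [e1, e2] at h
    simpa using h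
  rw [hβabs] at hce
  -- `(Xβ)^{L²} ≤ 8^{-L²}` and `64 L⁴ ≤ 8^{L²}`
  have hXβ : X * β ≤ 1 / 8 := by
    rw [le_div_iff₀ (by positivity)] at hbX
    rw [le_div_iff₀ (by norm_num : (0 : ℝ) < 8)]
    linarith
  have hXβ0 : 0 ≤ X * β := by positivity
  have hpow : (X * β) ^ (L ^ 2) ≤ (1 / 8) ^ (L ^ 2) := pow_le_pow_left₀ hXβ0 hXβ _
  have h64 : (64 : ℝ) * (L : ℝ) ^ 4 ≤ (8 : ℝ) ^ (L ^ 2) := by exact_mod_cast sixtyfour_mul_pow_four_le L hL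
  have h8 : (0 : ℝ) < (8 : ℝ) ^ (L ^ 2) := by positivity
  have hdef : 1 - twistedPartitionFunction r.ρ β L z q / twistedPartitionFunction r.ρ β L 1 q ≤ 1 / 2 := by
    have hce' : 1 - twistedPartitionFunction r.ρ β L z q / twistedPartitionFunction r.ρ β L 1 q ≤
        32 * (L : ℝ) ^ 4 * (X * β) ^ (L ^ 2) := by
      refine hce.trans (le_of_eq ?_)
      rw [hX_def]; push_cast; ring
    refine hce'.trans ?_
    calc 32 * (L : ℝ) ^ 4 * (X * β) ^ (L ^ 2) ≤ 32 * (L : ℝ) ^ 4 * (1 / 8) ^ (L ^ 2) := by gcongr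
      _ = (64 * (L : ℝ) ^ 4) / (8 : ℝ) ^ (L ^ 2) / 2 := by rw [div_pow, one_pow]; ring
      _ ≤ (8 : ℝ) ^ (L ^ 2) / (8 : ℝ) ^ (L ^ 2) / 2 := by gcongr
      _ = 1 / 2 := by rw [div_self h8.ne']
  linarith

end Summit.QuantumFields.YangMills.Theorems.FluxSectorAlternative

end
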